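import Summits.QuantumFields.BalabanUV.Beta.D1BFx.TwoPointTermBound
import Summits.QuantumFields.BalabanUV.Beta.D1BFx.ScaleLegBubbles

/-!
# `BalabanUV.Beta.D1BFx.TwoPointPairs` — road «BF-x» for binder row D1, «A3.c ∕ L-X TAILS» PART II (I3a): a PAIR of packaged two-point legs under
# the moment weight `w_μ w_ν` — the admissible case and the once-by-parts case, bounds fixed before the scale

HONEST DEPENDENCY (page 1, mandatory): continuum YM on T⁴ ⇐ BetaPertH ∧ nine spine estimates (0/9 proved); BetaPertH ⇐ (D1) ∧ (D4) ∧
CAP+tail; G-an2-4 gates asym, D1 and NE2/3/4.  HONEST FRAMING (cell contract, verbatim): «discharging `BetaPertH` makes Bałaban's UV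
stability UNCONDITIONAL — a real constructive-QFT result; it is NOT the continuum limit and NOT the Clay problem.»  THIS MODULE DISCHARGES
NOTHING of the wall: [folklore] real analysis about ARBITRARY functions `ℤ⁴ → ℝ` obeying stated rows — part (H) `TwoPointTermBound.weighted_term_bound`
and `tsum_byParts'` composed with part (D)'s moment-weight lemmas (`ScaleLegBubbles.abs_moment_weight_le/_shift_le/_diff_le`).  No `def`, no `Prop`
minted, nothing cited, 0 sorry.  0 wall binders; NOT an A3.c row, NOT (K), NOT D1, NOT `BetaPertH`, NOT continuum, NOT Clay.

ABSOLUTE RULE (cell charter, verbatim): «No internally-minted statement may enter as a cited fact. Every hypothesis is either kernel-proved in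
this package or a verbatim quotation of a PUBLISHED theorem with page reference. The manuscript(s) under audit are NOT citable for their own
disputed steps — they are the thing under adjudication; programme-internal (2001/route/tribunal) claims are never citable.»

WHY (this lineage's N-d1leaf03g12-2; the power counting of part (H)): a two-point leg with `k` end steps has far exponent `p = 2 + min k 1` and flat
window grade `n^{−p}`; under the degree-2 weight two legs are admissible iff BOTH are differenced (`p₁ = p₂ = 3`); a term with an undifferenced leg
`U` (`p = 2`) against a leg `L(· + a) − L` differenced along a MOVING step `a` is summed by parts once: the step lands on `U` (`V = U(· − a) − U`,
`p = 3`) under the shifted weight, plus `U·L` under the differenced weight (degree 1, `2 + 3 = 1 + 4`).  A PACKAGE for a function `H` at scale `n` is: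
a far soft row `(B, p)`, a split `H = F + Φ` with a free part `|F| ≤ A/(‖u‖∞+1)^q` and a flat part `|Φ| ≤ D/n^p`, and an `ℓ¹` envelope.
* [folklore] **`exists_pair_bound_main`** (`p₁ = p₂ = 3`, `q_i ≥ 3`, `q₁ + q₂ ≥ 7`): ONE `Bnd ≥ 0` before `n`; at every scale, for every pair of
  packaged functions and every `μ, ν`: summable and `|fullSum (w ↦ w_μw_ν·c·H₁(w+x)·H₂(w+y))| ≤ Bnd`.
* [folklore] **`exists_pair_bound_byParts`** (`U`: `p = 2`, `q_U ≥ 2`; `V = U(·−a) − U`: `p = 3`, `q_V ≥ 3`; `L`: `p = 3`, `q_L ≥ 3`; `q_U + q_L ≥ 6`,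
  `q_V + q_L ≥ 7`): the same for `w ↦ w_μw_ν·c·U(w+x)·(L(w+y+a) − L(w+y))`.
Unit `b2b-balaban-beta-d1-formalise-leaf-03` (gen 12), D1 formalisation swarm; `LEAVES-BFx.md` row «A3.c ∕ L-X TAILS» PART II (I3a).
-/

noncomputable section

namespace Summit.QuantumFields.BalabanUV.Beta.D1BFx.TwoPointPairs

open Literature.MathematicalPhysics.QuantumFieldTheory.Balaban1983to89 Literature.MathematicalPhysics.QuantumFieldTheory.Balaban1983to89.Beta
open B12Sec2to5 (l1)
open DyadicShell (Pt supNorm toReal toReal_apply)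
open WindowIdentification (fullSum fullSum_eq_tsum_sub)
open GradedBubbles (IsStep)
open ScaleLegBubbles (abs_moment_weight_le abs_moment_weight_shift_le abs_moment_weight_diff_le)
open TwoPointTermBound (weighted_term_bound tsum_byParts' summable_weighted_of_envelopes')

variable {δ : ℝ}

/-- [folklore] **THE ADMISSIBLE PAIR** (both legs differenced: far exponents `3, 3`; free exponents `q_i ≥ 3` with `q₁ + q₂ ≥ 7`; flat grades `n^{−3}`):
ONE bound, fixed before the scale, for `|fullSum (w ↦ w_μw_ν·c·H₁(w+x)·H₂(w+y))|`, for every scale `n ≥ 1`, every `μ, ν` and every pair of functions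
carrying the packages with the given constants (the `ℓ¹` envelopes serve summability only). -/
theorem exists_pair_bound_main (hδ : 0 < δ) {B₁ B₂ A₁ A₂ D₁ D₂ : ℝ} (hB₁ : 0 ≤ B₁) (hB₂ : 0 ≤ B₂) (hA₁ : 0 ≤ A₁) (hA₂ : 0 ≤ A₂)
    (hD₁ : 0 ≤ D₁) (hD₂ : 0 ≤ D₂) {q₁ q₂ : ℕ} (hq₁ : 3 ≤ q₁) (hq₂ : 3 ≤ q₂) (hqq : 7 ≤ q₁ + q₂) (c : ℝ) (x y : Pt) :
    ∃ Bnd : ℝ, 0 ≤ Bnd ∧ ∀ (n : ℕ), 1 ≤ n → ∀ (μ ν : Fin 4) (H₁ H₂ F₁ Φ₁ F₂ Φ₂ : Pt → ℝ),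
      (∀ u, H₁ u = F₁ u + Φ₁ u) → (∀ u, H₂ u = F₂ u + Φ₂ u) →
      (∀ u : Pt, |H₁ u| ≤ B₁ * Real.exp (-(δ / n) * supNorm u) / ((supNorm u : ℝ) + 1) ^ 3) →
      (∀ u : Pt, |H₂ u| ≤ B₂ * Real.exp (-(δ / n) * supNorm u) / ((supNorm u : ℝ) + 1) ^ 3) →
      (∀ u : Pt, |F₁ u| ≤ A₁ / ((supNorm u : ℝ) + 1) ^ q₁) → (∀ u : Pt, |F₂ u| ≤ A₂ / ((supNorm u : ℝ) + 1) ^ q₂) →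
      (∀ u : Pt, |Φ₁ u| ≤ D₁ / (n : ℝ) ^ 3) → (∀ u : Pt, |Φ₂ u| ≤ D₂ / (n : ℝ) ^ 3) →
      (∃ E₁ : ℝ, ∀ u : Pt, |H₁ u| ≤ E₁ * Real.exp (-(δ / n / 4) * l1 u)) →
      (∃ E₂ : ℝ, ∀ u : Pt, |H₂ u| ≤ E₂ * Real.exp (-(δ / n / 4) * l1 u)) →
      Summable (fun w : Pt => toReal w μ * toReal w ν * (c * (H₁ (w + x) * H₂ (w + y)))) ∧
      |fullSum (fun w : Pt => toReal w μ * toReal w ν * (c * (H₁ (w + x) * H₂ (w + y))))| ≤ Bnd := by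
  refine ⟨80 * (1 * |c| * 2 ^ 2 * (A₁ * ((supNorm x : ℝ) + 1) ^ q₁ * D₂ + D₁ * (A₂ * ((supNorm y : ℝ) + 1) ^ q₂) + D₁ * D₂))
        + 160 * (1 * |c| * 2 ^ 2 * (A₁ * ((supNorm x : ℝ) + 1) ^ q₁ * (A₂ * ((supNorm y : ℝ) + 1) ^ q₂)))
        + 80 * (1 * |c| * (B₁ * (Real.exp (δ * supNorm x) * ((supNorm x : ℝ) + 1) ^ 3)) * (B₂ * (Real.exp (δ * supNorm y) * ((supNorm y : ℝ) + 1) ^ 3)))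
          * (1 + 1 / δ),
    by positivity, fun n hn μ ν H₁ H₂ F₁ Φ₁ F₂ Φ₂ hH₁ hH₂ far₁ far₂ hF₁ hF₂ hΦ₁ hΦ₂ hE₁ hE₂ => ?_⟩
  obtain ⟨E₁, env₁⟩ := hE₁
  obtain ⟨E₂, env₂⟩ := hE₂
  have hn0 : (0 : ℝ) < n := by exact_mod_cast hn
  have hδ' : 0 < δ / n / 4 := by positivity
  obtain ⟨hs, hf, -⟩ := weighted_term_bound (P := fun w : Pt => toReal w μ * toReal w ν) (c := c) (x := x) (y := y) hn hδ zero_le_one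
    (fun w => abs_moment_weight_le μ ν w) le_rfl hH₁ hH₂ hB₁ hB₂ hA₁ hA₂ hD₁ hD₂ far₁ far₂ hF₁ hF₂ hΦ₁ hΦ₂
    (by omega) (by omega) (by omega) (by norm_num) (by norm_num) (by norm_num) hδ' env₁ env₂
  exact ⟨hs, hf⟩

/-- [folklore] **THE ONCE-BY-PARTS PAIR**: `U` undifferenced (far exponent `2`, flat grade `n^{−2}`, free exponent `q_U ≥ 2`), `V = U(· − a) − U` its
moving difference (exponent `3`, `q_V ≥ 3`), `L` differenced (exponent `3`, `q_L ≥ 3`), `q_U + q_L ≥ 6`, `q_V + q_L ≥ 7`, `a` a unit step: ONE bound,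
fixed before the scale, for `|fullSum (w ↦ w_μw_ν·c·U(w+x)·(L(w+y+a) − L(w+y)))|` (by parts: `V·L` under the shifted weight, degree 2, plus `U·L`
under the differenced weight, degree 1; `fullSum = Σ'` because the weight vanishes at the origin). -/
theorem exists_pair_bound_byParts (hδ : 0 < δ) {B_U B_V B_L A_U A_V A_L D_U D_V D_L : ℝ} (hB_U : 0 ≤ B_U) (hB_V : 0 ≤ B_V) (hB_L : 0 ≤ B_L)
    (hA_U : 0 ≤ A_U) (hA_V : 0 ≤ A_V) (hA_L : 0 ≤ A_L) (hD_U : 0 ≤ D_U) (hD_V : 0 ≤ D_V) (hD_L : 0 ≤ D_L) {q_U q_V q_L : ℕ}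
    (hq_U : 2 ≤ q_U) (hq_V : 3 ≤ q_V) (hq_L : 3 ≤ q_L) (hUL : 6 ≤ q_U + q_L) (hVL : 7 ≤ q_V + q_L) (c : ℝ) (x y : Pt) {a : Pt} (ha : IsStep a) :
    ∃ Bnd : ℝ, 0 ≤ Bnd ∧ ∀ (n : ℕ), 1 ≤ n → ∀ (μ ν : Fin 4) (U V L F_U Φ_U F_V Φ_V F_L Φ_L : Pt → ℝ),
      (∀ u, V u = U (u - a) - U u) →
      (∀ u, U u = F_U u + Φ_U u) → (∀ u, V u = F_V u + Φ_V u) → (∀ u, L u = F_L u + Φ_L u) →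
      (∀ u : Pt, |U u| ≤ B_U * Real.exp (-(δ / n) * supNorm u) / ((supNorm u : ℝ) + 1) ^ 2) →
      (∀ u : Pt, |V u| ≤ B_V * Real.exp (-(δ / n) * supNorm u) / ((supNorm u : ℝ) + 1) ^ 3) →
      (∀ u : Pt, |L u| ≤ B_L * Real.exp (-(δ / n) * supNorm u) / ((supNorm u : ℝ) + 1) ^ 3) →
      (∀ u : Pt, |F_U u| ≤ A_U / ((supNorm u : ℝ) + 1) ^ q_U) → (∀ u : Pt, |F_V u| ≤ A_V / ((supNorm u : ℝ) + 1) ^ q_V) →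
      (∀ u : Pt, |F_L u| ≤ A_L / ((supNorm u : ℝ) + 1) ^ q_L) →
      (∀ u : Pt, |Φ_U u| ≤ D_U / (n : ℝ) ^ 2) → (∀ u : Pt, |Φ_V u| ≤ D_V / (n : ℝ) ^ 3) → (∀ u : Pt, |Φ_L u| ≤ D_L / (n : ℝ) ^ 3) →
      (∃ E : ℝ, ∀ u : Pt, |U u| ≤ E * Real.exp (-(δ / n / 4) * l1 u)) → (∃ E : ℝ, ∀ u : Pt, |V u| ≤ E * Real.exp (-(δ / n / 4) * l1 u)) →
      (∃ E : ℝ, ∀ u : Pt, |L u| ≤ E * Real.exp (-(δ / n / 4) * l1 u)) →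
      Summable (fun w : Pt => toReal w μ * toReal w ν * (c * (U (w + x) * (L (w + (y + a)) - L (w + y))))) ∧
      |fullSum (fun w : Pt => toReal w μ * toReal w ν * (c * (U (w + x) * (L (w + (y + a)) - L (w + y)))))| ≤ Bnd := by
  refine ⟨80 * (1 * |c| * 2 ^ 2 * (A_V * ((supNorm x : ℝ) + 1) ^ q_V * D_L + D_V * (A_L * ((supNorm y : ℝ) + 1) ^ q_L) + D_V * D_L))
        + 160 * (1 * |c| * 2 ^ 2 * (A_V * ((supNorm x : ℝ) + 1) ^ q_V * (A_L * ((supNorm y : ℝ) + 1) ^ q_L)))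
        + 80 * (1 * |c| * (B_V * (Real.exp (δ * supNorm x) * ((supNorm x : ℝ) + 1) ^ 3)) * (B_L * (Real.exp (δ * supNorm y) * ((supNorm y : ℝ) + 1) ^ 3)))
          * (1 + 1 / δ)
        + 1 * |c| * (B_V * (Real.exp (δ * supNorm x) * ((supNorm x : ℝ) + 1) ^ 3)) * (B_L * (Real.exp (δ * supNorm y) * ((supNorm y : ℝ) + 1) ^ 3))
      + (80 * (3 * |c| * 2 ^ 1 * (A_U * ((supNorm x : ℝ) + 1) ^ q_U * D_L + D_U * (A_L * ((supNorm y : ℝ) + 1) ^ q_L) + D_U * D_L))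
        + 160 * (3 * |c| * 2 ^ 1 * (A_U * ((supNorm x : ℝ) + 1) ^ q_U * (A_L * ((supNorm y : ℝ) + 1) ^ q_L)))
        + 80 * (3 * |c| * (B_U * (Real.exp (δ * supNorm x) * ((supNorm x : ℝ) + 1) ^ 2)) * (B_L * (Real.exp (δ * supNorm y) * ((supNorm y : ℝ) + 1) ^ 3)))
          * (1 + 1 / δ)
        + 3 * |c| * (B_U * (Real.exp (δ * supNorm x) * ((supNorm x : ℝ) + 1) ^ 2)) * (B_L * (Real.exp (δ * supNorm y) * ((supNorm y : ℝ) + 1) ^ 3))),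
    by positivity, fun n hn μ ν U V L F_U Φ_U F_V Φ_V F_L Φ_L hV hU hVs hL farU farV farL fU fV fL flU flV flL hEU hEV hEL => ?_⟩
  obtain ⟨E_U, envU⟩ := hEU
  obtain ⟨E_V, envV⟩ := hEV
  obtain ⟨E_L, envL⟩ := hEL
  have hn0 : (0 : ℝ) < n := by exact_mod_cast hn
  have hδ' : 0 < δ / n / 4 := by positivity
  have hneg : IsStep (-a) := ha.neg
  have hQw : ∀ w : Pt, |(fun w : Pt => toReal w μ * toReal w ν) w| ≤ 1 * ((supNorm w : ℝ) + 1) ^ 2 := fun w => abs_moment_weight_le μ ν w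
  have hQs : ∀ w : Pt, |(fun w : Pt => toReal (w - a) μ * toReal (w - a) ν) w| ≤ 1 * ((supNorm w : ℝ) + 1) ^ 2 := fun w => by
    beta_reduce; rw [show w - a = w + -a from sub_eq_add_neg w a]; exact abs_moment_weight_shift_le μ ν hneg w
  have hQd : ∀ w : Pt, |(fun w : Pt => toReal (w - a) μ * toReal (w - a) ν - toReal w μ * toReal w ν) w| ≤ 3 * ((supNorm w : ℝ) + 1) ^ 1 :=
    fun w => by beta_reduce; rw [show w - a = w + -a from sub_eq_add_neg w a]; exact abs_moment_weight_diff_le μ ν hneg w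
  -- summability of the four by-parts pieces and of the target
  have hS1 : Summable fun w : Pt => toReal w μ * toReal w ν * (c * (U (w + x) * L (w + (y + a)))) :=
    summable_weighted_of_envelopes' (P := fun w : Pt => toReal w μ * toReal w ν) (x := x) (y := y + a) hδ' hQw le_rfl envU envL
  have hS2 : Summable fun w : Pt => toReal w μ * toReal w ν * (c * (U (w + x) * L (w + y))) :=
    summable_weighted_of_envelopes' (P := fun w : Pt => toReal w μ * toReal w ν) (x := x) (y := y) hδ' hQw le_rfl envU envL
  have eV : ∀ w : Pt, U (w + x - a) - U (w + x) = V (w + x) := fun w => (hV (w + x)).symm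
  have hS3 : Summable fun w : Pt => toReal (w - a) μ * toReal (w - a) ν * (c * ((U (w + x - a) - U (w + x)) * L (w + y))) := by
    simp only [eV]
    exact summable_weighted_of_envelopes' (P := fun w : Pt => toReal (w - a) μ * toReal (w - a) ν) (x := x) (y := y) hδ' hQs le_rfl envV envL
  have hS4 : Summable fun w : Pt => (toReal (w - a) μ * toReal (w - a) ν - toReal w μ * toReal w ν) * (c * (U (w + x) * L (w + y))) :=
    summable_weighted_of_envelopes' (P := fun w : Pt => toReal (w - a) μ * toReal (w - a) ν - toReal w μ * toReal w ν) (x := x) (y := y)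
      hδ' hQd (by norm_num) envU envL
  have eT : (fun w : Pt => toReal w μ * toReal w ν * (c * (U (w + x) * (L (w + (y + a)) - L (w + y))))) =
      fun w => toReal w μ * toReal w ν * (c * (U (w + x) * L (w + (y + a)))) - toReal w μ * toReal w ν * (c * (U (w + x) * L (w + y))) := by
    funext w; ring
  have hS : Summable fun w : Pt => toReal w μ * toReal w ν * (c * (U (w + x) * (L (w + (y + a)) - L (w + y)))) := by
    rw [eT]; exact hS1.sub hS2
  refine ⟨hS, ?_⟩
  -- the two admissible pieces (part (H))
  obtain ⟨-, -, h3⟩ := weighted_term_bound (P := fun w : Pt => toReal (w - a) μ * toReal (w - a) ν) (c := c) (x := x) (y := y) hn hδ zero_le_one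
    hQs le_rfl hVs hL hB_V hB_L hA_V hA_L hD_V hD_L farV farL fV fL flV flL
    (by omega) (by omega) (by omega) (by norm_num) (by norm_num) (by norm_num) hδ' envV envL
  obtain ⟨-, -, h4⟩ := weighted_term_bound (P := fun w : Pt => toReal (w - a) μ * toReal (w - a) ν - toReal w μ * toReal w ν) (c := c)
    (x := x) (y := y) hn hδ (by norm_num : (0 : ℝ) ≤ 3) hQd (by norm_num : 1 ≤ 2) hU hL hB_U hB_L hA_U hA_L hD_U hD_L farU farL fU fL flU flL
    (by omega) (by omega) (by omega) (by norm_num) (by norm_num) (by norm_num) hδ' envU envL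
  -- by parts; the weight vanishes at the origin
  have hbp := tsum_byParts' (Q := fun w : Pt => toReal w μ * toReal w ν) (H₁ := U) (H₂ := L) (c := c) x y a hS1 hS2 hS3 hS4
  rw [fullSum_eq_tsum_sub _ hS, hbp]
  have hz : toReal (0 : Pt) μ * toReal (0 : Pt) ν * (c * (U (0 + x) * (L (0 + (y + a)) - L (0 + y)))) = 0 := by simp [toReal_apply]
  rw [hz, sub_zero]
  simp only [eV]
  exact (abs_add_le _ _).trans (add_le_add h3 h4)

end Summit.QuantumFields.BalabanUV.Beta.D1BFx.TwoPointPairs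

end
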